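import Literature.RingTheory.FittingIdeal.FittingLemma
import Mathlib.LinearAlgebra.Dimension.Free
import Mathlib.LinearAlgebra.Basis.VectorSpace
import HarnessLib

/-!
# The Fitting ideals of a free module (Stacks 07Z7 / 07ZB)

Topic: `Literature/RingTheory/FittingIdeal`. With Fitting's lemma (`FittingLemma.lean`) available
for the intrinsic `Module.fittingIdeal` of `Basic.lean`, the Fitting ideals of a FREE module over
any commutative ring are computed on a basis, which has no non-zero relation. PROVED:

* `Module.fittingIdeal_of_basis` — **Stacks 07Z7/07ZB**: for a module with a basis of `d`
  elements, `Fitt_k = R` for `d ≤ k` and `Fitt_k = 0` for `k < d`;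
* over a field: `Fitt_k(V) = K ↔ dim V ≤ k` and `Fitt_k(V) = 0 ↔ k < dim V`
  (`Module.fittingIdeal_eq_top_iff_finrank_le`, `Module.fittingIdeal_eq_bot_iff_lt_finrank`;
  the implication `k < dim V → Fitt_k(V) = 0` is also `Module.fittingIdeal_eq_bot_of_lt_finrank`
  of `LocalRing.lean`, proved there by a dimension count without Fitting's lemma).

## Sources

* The Stacks Project, Tag 07Z7, Tag 07ZB (Fitting ideals of free and of finite locally free
  modules). [StacksProject]
* D. Eisenbud, *Commutative Algebra with a View Toward Algebraic Geometry*, GTM 150 (1995),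
  §20.2. [Eisenbud1995]
-/

namespace Literature.RingTheory.FittingIdeal

universe u v

variable {R : Type u} [CommRing R] {M : Type v} [AddCommGroup M] [Module R M]

/-! ## Free modules -/

/-- **Stacks 07Z7 — the Fitting ideals of a free module**: if `M` has a basis of `d` elements,
then `Fitt_k(M) = R` for `d ≤ k` and `Fitt_k(M) = 0` for `k < d`. By Fitting's lemma computed
on the basis, which has no non-zero relation: the `(d - k)`-minors of zero matrices vanish as
soon as `d - k ≥ 1`, and the empty minor is `1`. [cite: StacksProject, Tag 07Z7] -/
theorem Module.fittingIdeal_of_basis {d : ℕ} (b : Module.Basis (Fin d) R M) (k : ℕ) :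
    Module.fittingIdeal R M k = if d ≤ k then ⊤ else ⊥ := by
  rw [Module.fittingIdeal_eq_relMinorIdeal b b.span_eq k]
  split_ifs with h
  · rw [show d - k = 0 by omega, Module.relMinorIdeal_zero]
  · obtain ⟨j, hj⟩ : ∃ j, d - k = j + 1 := ⟨d - k - 1, by omega⟩
    rw [hj, eq_bot_iff, Module.relMinorIdeal_le_iff]
    intro ρ σ hρ
    -- a basis has only the zero relations
    have hρ0 : ∀ i l, ρ i l = 0 := fun i =>
      Fintype.linearIndependent_iff.1 b.linearIndependent (ρ i) (hρ i)
    have hz : (Matrix.of fun i i' => ρ i (σ i')) = 0 := by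
      ext i i'
      simp only [Matrix.of_apply, hρ0, Matrix.zero_apply]
    rw [hz, Matrix.det_zero]
    exact Submodule.zero_mem _

/-- Over a field: `Fitt_k(V) = K` iff `dim V ≤ k`. [cite: StacksProject, Tag 07Z7] -/
theorem Module.fittingIdeal_eq_top_iff_finrank_le {K : Type u} [Field K] {V : Type v}
    [AddCommGroup V] [Module K V] [Module.Finite K V] (k : ℕ) :
    Module.fittingIdeal K V k = ⊤ ↔ Module.finrank K V ≤ k := by
  rw [Module.fittingIdeal_of_basis (Module.finBasis K V) k]
  constructor
  · intro h
    by_contra hlt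
    rw [if_neg hlt] at h
    exact bot_ne_top h
  · intro h
    rw [if_pos h]

/-- Over a field: `Fitt_k(V) = 0` iff `k < dim V`. [cite: StacksProject, Tag 07Z7] -/
theorem Module.fittingIdeal_eq_bot_iff_lt_finrank {K : Type u} [Field K] {V : Type v}
    [AddCommGroup V] [Module K V] [Module.Finite K V] (k : ℕ) :
    Module.fittingIdeal K V k = ⊥ ↔ k < Module.finrank K V := by
  rw [Module.fittingIdeal_of_basis (Module.finBasis K V) k]
  constructor
  · intro h
    by_contra hlt
    rw [if_pos (not_lt.mp hlt)] at h
    exact top_ne_bot h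
  · intro h
    rw [if_neg (not_le.mpr h)]

end Literature.RingTheory.FittingIdeal
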